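import Literature.AlgebraicGeometry.Resolution.ResolutionOfCurves
import Literature.AlgebraicGeometry.Resolution.ComponentGluing
import HarnessLib

/-!
# Resolution of singularities: reduction to the irreducible components

Topic: `Literature/AlgebraicGeometry/Resolution`. Cossart–Piltant 2019, proof of Prop. 4.6
(arXiv v1: Prop. 4.4), **Step 1**: "it can be assumed that `𝒳` is irreducible … There is a finite
birational morphism `f : ∐ᵢ 𝒳ᵢ → 𝒳`, isomorphic above `Reg 𝒳`. The theorem holds for `𝒳` if it
holds for each `𝒳ᵢ`." We prove this reduction over Mathlib for the weak notion of resolution of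
`ResolutionOfSingularities.lean` (`Scheme.HasResolution`: proper + birational + regular source):

* `isProper_coprodDesc` — `coprod.desc f g` is proper when `f` and `g` are;
* `isBirational_coprodDesc_of_closed_cover` — if the reduced scheme `X` is covered by two closed
  subschemes `C`, `D` with mutually dense complements and `ρ₁ : C' → C`, `ρ₂ : D' → D` are
  birational, then `C' ⨿ D' → X` is birational (the core of the glue
  `exists_finite_resolution_of_closed_cover` of `ResolutionGlue.lean`, extracted);
* `hasResolution_of_closed_cover` — hence resolutions of `C` and `D` give one of `X`;
* `hasResolution_subscheme_biUnion`, `hasResolution_of_irreducibleComponents` — a reduced scheme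
  with finitely many irreducible components has a resolution as soon as each component, with its
  reduced (= integral) closed-subscheme structure, has one (induction on the number of
  components);
* `hasResolution_of_forall_closeds` — a reduced `k`-scheme of finite type has a resolution as
  soon as all its integral closed subschemes do;
* `IntegralResolutionOverUpToDim k d`, `IntegralResolutionInChar p` — resolution for *integral*
  separated `k`-schemes of finite type (of dimension `≤ d`, resp. over fields of characteristic
  `p`) — and the equivalences `resolutionOverUpToDim_iff_integral`,
  `cossartPiltant2019_iff_integral`, `resolutionInChar_iff_integral`,
  `hironaka1964_iff_integral`, `resolutionOfSingularities_iff_integral`: each of the resolution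
  statements of this topic is equivalent to its integral case.

Since `defn-ComponentGluing` the proofs live in the narrow-import module `ComponentGluing.lean`
(import cone `ResolutionGlue` only): every theorem of this file except the
`IntegralResolutionOverUpToDim` / `ResolutionOverUpToDim` / `CossartPiltant2019` corollaries is a
one-line restatement of its canonical copy `ComponentGluing.<same name>` (for the three
`…_iff_integral` equivalences: the copy with `IntegralResolutionInChar` unfolded); the names and
statements here are unchanged. Import `ComponentGluing` instead of this file when only the glue is
needed.

## Sources

* V. Cossart, O. Piltant, *Resolution of singularities of arithmetical threefolds*, J. Algebra 529
  (2019) 268–535, proof of Prop. 4.6, Step 1 (arXiv:1412.0868 v1: Prop. 4.4).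
* J. Kollár, *Lectures on Resolution of Singularities*, Ann. of Math. Stud. 166, PUP 2007, Ch. 3
  (resolution is constructed for each irreducible component separately).
-/

noncomputable section

open CategoryTheory CategoryTheory.Limits AlgebraicGeometry TopologicalSpace Topology

namespace Literature.AlgebraicGeometry.Resolution

universe u

/-! ## Properness and birationality of `C' ⨿ D' → X` -/

section Glue

/-- `coprod.desc f g : U ⨿ V ⟶ X` is proper when `f` and `g` are (it factors as
`coprod.map f g` — proper, the property being local on the target — followed by the finite fold
map `X ⨿ X ⟶ X`). [folklore] -/
theorem isProper_coprodDesc {U V X : Scheme.{u}} (f : U ⟶ X) (g : V ⟶ X) [IsProper f]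
    [IsProper g] : IsProper (coprod.desc f g) := ComponentGluing.isProper_coprodDesc f g

/-- **Birationality of `C' ⨿ D' → X` along a closed cover.** Let the reduced scheme `X` be covered
by two closed subschemes `ι₁ : C ↪ X`, `ι₂ : D ↪ X` such that the complement of `D` is dense in
`C` and the complement of `C` is dense in `D`. If `ρ₁ : C' → C` and `ρ₂ : D' → D` are birational,
so is `coprod.desc (ρ₁ ≫ ι₁) (ρ₂ ≫ ι₂) : C' ⨿ D' → X` (it is an isomorphism over the dense open
`(O₁ ∖ D) ∪ (O₂ ∖ C)`, where `ρᵢ` is an isomorphism over `Oᵢ`).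
[cite: CossartPiltant2019, proof of Prop. 4.6, Step 1 (arXiv v1: Prop. 4.4)] -/
theorem isBirational_coprodDesc_of_closed_cover {C D C' D' X : Scheme.{u}} [IsReduced X]
    (ι₁ : C ⟶ X) (ι₂ : D ⟶ X) [IsClosedImmersion ι₁] [IsClosedImmersion ι₂]
    (hcov : Set.range ι₁ ∪ Set.range ι₂ = Set.univ)
    (hd₁ : Dense (ι₁ ⁻¹' (Set.range ι₂)ᶜ)) (hd₂ : Dense (ι₂ ⁻¹' (Set.range ι₁)ᶜ))
    {ρ₁ : C' ⟶ C} {ρ₂ : D' ⟶ D} (hρ₁ : IsBirational ρ₁) (hρ₂ : IsBirational ρ₂) :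
    IsBirational (coprod.desc (ρ₁ ≫ ι₁) (ρ₂ ≫ ι₂)) :=
  ComponentGluing.isBirational_coprodDesc_of_closed_cover ι₁ ι₂ hcov hd₁ hd₂ hρ₁ hρ₂

/-- **Gluing resolutions along a closed cover** ("the theorem holds for `𝒳` if it holds for each
`𝒳ᵢ`"): if the reduced scheme `X` is covered by closed subschemes `C`, `D` with mutually dense
complements and `C`, `D` admit resolutions of singularities, so does `X` — the disjoint union
`C' ⨿ D' → X` of the two resolutions is proper (`isProper_coprodDesc`), birational
(`isBirational_coprodDesc_of_closed_cover`) and has regular source.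
[cite: CossartPiltant2019, proof of Prop. 4.6, Step 1 (arXiv v1: Prop. 4.4)] -/
theorem hasResolution_of_closed_cover {C D X : Scheme.{u}} [IsReduced X]
    (ι₁ : C ⟶ X) (ι₂ : D ⟶ X) [IsClosedImmersion ι₁] [IsClosedImmersion ι₂]
    (hcov : Set.range ι₁ ∪ Set.range ι₂ = Set.univ)
    (hd₁ : Dense (ι₁ ⁻¹' (Set.range ι₂)ᶜ)) (hd₂ : Dense (ι₂ ⁻¹' (Set.range ι₁)ᶜ))
    (h₁ : Scheme.HasResolution C) (h₂ : Scheme.HasResolution D) : Scheme.HasResolution X :=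
  ComponentGluing.hasResolution_of_closed_cover ι₁ ι₂ hcov hd₁ hd₂ h₁ h₂

/-- Resolutions transport along isomorphisms of the target. [folklore] -/
theorem Scheme.HasResolution.of_iso {X Z : Scheme.{u}} (g : X ⟶ Z) [IsIso g]
    (h : Scheme.HasResolution X) : Scheme.HasResolution Z :=
  ComponentGluing.Scheme.HasResolution.of_iso g h

end Glue

/-! ## Induction over the irreducible components -/

section Components

open Scheme.IdealSheafData

variable {X : Scheme.{u}}

/-- **Resolution of a finite union of irreducible components** of a reduced scheme, given a
resolution of each component with its reduced (hence integral) closed-subscheme structure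
`(vanishingIdeal Z).subscheme` (induction on the number of components, gluing along
`hasResolution_of_closed_cover`).
[cite: CossartPiltant2019, proof of Prop. 4.6, Step 1 (arXiv v1: Prop. 4.4)] -/
theorem hasResolution_subscheme_biUnion
    (hres : ∀ Z : Closeds X, (Z : Set X) ∈ irreducibleComponents X →
      Scheme.HasResolution (vanishingIdeal Z).subscheme)
    (S : Finset (Set X)) (hS : (S : Set (Set X)) ⊆ irreducibleComponents X) (T : Closeds X)
    (hT : (T : Set X) = ⋃ Z ∈ S, Z) :
    Scheme.HasResolution (vanishingIdeal T).subscheme :=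
  ComponentGluing.hasResolution_subscheme_biUnion hres S hS T hT

/-- **Reduction of resolution to the irreducible components**: a reduced scheme with finitely
many irreducible components (e.g. a Noetherian scheme) has a resolution of singularities as soon
as each of its irreducible components, with the reduced (= integral) closed-subscheme structure,
has one. [cite: CossartPiltant2019, proof of Prop. 4.6, Step 1 (arXiv v1: Prop. 4.4)] -/
theorem hasResolution_of_irreducibleComponents (X : Scheme.{u}) [IsReduced X]
    (hfin : (irreducibleComponents (X : Type u)).Finite)
    (hres : ∀ Z : Closeds X, (Z : Set X) ∈ irreducibleComponents X →
      Scheme.HasResolution (vanishingIdeal Z).subscheme) :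
    Scheme.HasResolution X := ComponentGluing.hasResolution_of_irreducibleComponents X hfin hres

/-- The integral closed subscheme on an irreducible component. [folklore] -/
theorem isIntegral_subscheme_of_mem_irreducibleComponents (Z : Closeds X)
    (hZ : (Z : Set X) ∈ irreducibleComponents X) : IsIntegral (vanishingIdeal Z).subscheme :=
  ComponentGluing.isIntegral_subscheme_of_mem_irreducibleComponents Z hZ

end Components

/-! ## The resolution statements are equivalent to their integral cases -/

section Integral

open Scheme.IdealSheafData

/-- **Resolution for integral `k`-schemes of finite type up to dimension `d`**: every integral
separated `k`-scheme of finite type with `dim X ≤ d` has a resolution of singularities — the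
integral case of `ResolutionOverUpToDim k d` (`ArithmeticalThreefolds.lean`). [folklore] -/
def IntegralResolutionOverUpToDim (k : Type u) [Field k] (d : ℕ) : Prop :=
  ∀ (X : Scheme.{u}) (f : X ⟶ Spec (.of k)),
    IsSeparated f → LocallyOfFiniteType f → QuasiCompact f → IsIntegral X →
      topologicalKrullDim X ≤ d → Scheme.HasResolution X

variable {k : Type u} [Field k]

/-- A reduced `k`-scheme `X` of finite type has a resolution as soon as every integral closed
subscheme `Z ↪ X` has one (`X` is Noetherian, so it has finitely many irreducible components;
apply `hasResolution_of_irreducibleComponents`).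
[cite: CossartPiltant2019, proof of Prop. 4.6, Step 1 (arXiv v1: Prop. 4.4)] -/
theorem hasResolution_of_forall_closeds (X : Scheme.{u}) (f : X ⟶ Spec (.of k))
    [LocallyOfFiniteType f] [QuasiCompact f] [IsReduced X]
    (h : ∀ Z : Closeds X, IsIntegral (vanishingIdeal Z).subscheme →
      Scheme.HasResolution (vanishingIdeal Z).subscheme) :
    Scheme.HasResolution X := ComponentGluing.hasResolution_of_forall_closeds X f h

/-- `ResolutionOverUpToDim k d` follows from its integral case: resolve each irreducible
component (an integral closed subscheme, again separated of finite type over `k` and of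
dimension `≤ d`) and glue. [cite: CossartPiltant2019, proof of Prop. 4.6, Step 1 (arXiv v1:
Prop. 4.4)] -/
theorem IntegralResolutionOverUpToDim.resolutionOverUpToDim {d : ℕ}
    (h : IntegralResolutionOverUpToDim k d) : ResolutionOverUpToDim k d := by
  intro X f hsep hft hqc hred hdim
  refine hasResolution_of_forall_closeds X f fun Z hZ => ?_
  let ι := (vanishingIdeal Z).subschemeι
  refine h _ (ι ≫ f) inferInstance inferInstance inferInstance hZ ?_
  exact (ι.isClosedEmbedding.isInducing.topologicalKrullDim_le).trans hdim

/-- Conversely the integral case is a special case. [folklore] -/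
theorem ResolutionOverUpToDim.integral {d : ℕ} (h : ResolutionOverUpToDim k d) :
    IntegralResolutionOverUpToDim k d := by
  intro X f hsep hft hqc hint hdim
  exact h X f hsep hft hqc inferInstance hdim

/-- **`ResolutionOverUpToDim k d` is equivalent to its integral case.**
[cite: CossartPiltant2019, proof of Prop. 4.6, Step 1 (arXiv v1: Prop. 4.4)] -/
theorem resolutionOverUpToDim_iff_integral {d : ℕ} :
    ResolutionOverUpToDim k d ↔ IntegralResolutionOverUpToDim k d :=
  ⟨ResolutionOverUpToDim.integral, IntegralResolutionOverUpToDim.resolutionOverUpToDim⟩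

/-- **`CossartPiltant2019` is equivalent to its integral case**: resolution of *integral*
separated schemes of finite type of dimension `≤ 3` over every field already gives the vendored
statement for reduced ones. [cite: CossartPiltant2019, proof of Prop. 4.6, Step 1 (arXiv v1:
Prop. 4.4)] -/
theorem cossartPiltant2019_iff_integral :
    CossartPiltant2019.{u} ↔ ∀ (k : Type u) [Field k], IntegralResolutionOverUpToDim k 3 := by
  rw [cossartPiltant2019_iff]
  exact ⟨fun h k _ => (h k).integral, fun h k _ => (h k).resolutionOverUpToDim⟩

/-- **Resolution in characteristic `p` for integral schemes**: the integral case of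
`ResolutionInChar p`. [folklore] -/
def IntegralResolutionInChar (p : ℕ) : Prop :=
  ∀ (k : Type u) [Field k] [CharP k p] (X : Scheme.{u}) (f : X ⟶ Spec (.of k)),
    IsSeparated f → LocallyOfFiniteType f → QuasiCompact f → IsIntegral X →
      Scheme.HasResolution X

/-- **`ResolutionInChar p` is equivalent to its integral case** (resolve the components and
glue). [cite: CossartPiltant2019, proof of Prop. 4.6, Step 1 (arXiv v1: Prop. 4.4)] -/
theorem resolutionInChar_iff_integral (p : ℕ) :
    ResolutionInChar.{u} p ↔ IntegralResolutionInChar.{u} p :=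
  ComponentGluing.resolutionInChar_iff_integral p

/-- `Hironaka1964` (resolution in characteristic zero, weak form) is equivalent to its integral
case. [folklore] -/
theorem hironaka1964_iff_integral : Hironaka1964.{u} ↔ IntegralResolutionInChar.{u} 0 :=
  ComponentGluing.hironaka1964_iff_integral

/-- The summit conjunct `ResolutionOfSingularities` is equivalent to resolution of *integral*
separated schemes of finite type over fields of every prime characteristic. [folklore] -/
theorem resolutionOfSingularities_iff_integral :
    ResolutionOfSingularities ↔ ∀ p : ℕ, p.Prime → IntegralResolutionInChar.{0} p :=
  ComponentGluing.resolutionOfSingularities_iff_integral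

end Integral

end Literature.AlgebraicGeometry.Resolution

end
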